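import Literature.Analysis.FunctionSpaces.TorusHolderBridge
import Literature.Analysis.FunctionSpaces.HolderInterpolation
import Mathlib.Topology.ContinuousMap.Compact
import HarnessLib

/-!
# K3L `LagrangianCarrierConstruction` (stmt-AnomalousDissipation-24913), line `birth`, stub `stub_regularL`: a jointly continuous family of
# smooth torus fields with bounded gradients is continuous in time in every Hölder norm `C^{0,r}`, `r < 1` (helper;
# `--supports stmt-AnomalousDissipation-24913`)

Summits-side helper file (everything proved; no definitions, no named facts). Fifth brick towards `stub_regularL`: the QUALITATIVE input
`‖b (m+1) t − b (m+1) t₀‖_{C^{0,r}} → 0` (`t → t₀`) of the reduction `…RegularLReduction.regular_of_levelBounds` follows from the clauses (L1)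
(joint continuity), (L3a) (smoothness) and (L3b) with `n = 1` (gradient bound uniform in time): the sup norm of the difference tends to `0` by
uniform continuity on the compact torus (`ContinuousMap.curry`), the difference is Lipschitz uniformly in time, and the interpolation
`[f]_r ≤ L δ^{1-r} + osc(f) δ^{-r}` at the scale `δ = osc(f)` gives `[f]_r ≤ (L + 1) osc(f)^{1-r} → 0`
(`tendsto_eBoundedHolderNorm_sub`). Infrastructure for route-1's rung leaf F-D1.A0 (a frontier FORMAL rung); NOT a proof of anomalous dissipation.
-/

set_option linter.dupNamespace false

noncomputable section

namespace Summit.AnomalousDissipation.AnomalousDissipation.Theorems.SolenoidalFractalHomogenisation.LagrangianCarrierConstruction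

open Set Function Filter Topology
open scoped NNReal ENNReal
open Literature.Analysis Literature.Analysis.FunctionSpaces Literature.Analysis.FunctionSpaces.Torus

variable {V : Type*} [NormedAddCommGroup V] [NormedSpace ℝ V]

omit [NormedSpace ℝ V] in
/-- Interpolation at the scale of the oscillation: an `L`-Lipschitz map with oscillation `≤ B` is `r`-Hölder with constant
`(L + 1) B^{1-r}` (`r < 1`). [folklore] -/
theorem holderWith_of_lipschitzWith_of_osc {X : Type*} [PseudoEMetricSpace X] {f : X → V} {L B : ℝ≥0} (hL : LipschitzWith L f)
    (hB : ∀ x y, edist (f x) (f y) ≤ B) {r : ℝ≥0} (hr : r < 1) :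
    HolderWith ((L + 1) * B ^ (1 - r : ℝ)) r f := by
  by_cases hB0 : B = 0
  · intro x y
    have h := hB x y
    rw [hB0, ENNReal.coe_zero, nonpos_iff_eq_zero] at h
    rw [h]
    exact bot_le
  · have h := holderWith_of_lipschitzWith_of_edist_le hL hB hr.le (pos_iff_ne_zero.mpr hB0)
    have e : L * B ^ (1 - r : ℝ) + B * B⁻¹ ^ (r : ℝ) = (L + 1) * B ^ (1 - r : ℝ) := by
      have h1 : B * B⁻¹ ^ (r : ℝ) = B ^ (1 - r : ℝ) := by
        rw [NNReal.inv_rpow, ← div_eq_mul_inv, NNReal.rpow_sub' (by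
          have : (r : ℝ) < 1 := by exact_mod_cast hr
          linarith), NNReal.rpow_one]
      rw [h1]; ring
    rwa [e] at h

variable {d : Type*} [Fintype d] [DecidableEq d]

/-- **Continuity in time in `C^{0,r}` from joint continuity and a uniform gradient bound.** If `b : ℝ → 𝕋ᵈ → V` is jointly continuous,
each `b t` is smooth and `‖D(lift (b t))‖ ≤ C` uniformly in `t` (through `iteratedFDeriv ℝ 1`), then for every `r < 1`,
`‖b t − b t₀‖_{C^{0,r}} → 0` as `t → t₀`. [folklore] -/
theorem tendsto_eBoundedHolderNorm_sub (b : ℝ → UnitAddTorus d → V) (h1 : Continuous (uncurry b))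
    (h3a : ∀ t, IsSmooth (b t)) (h3b : ∃ C : ℝ, ∀ t y, ‖iteratedFDeriv ℝ 1 (Torus.lift (b t)) y‖ ≤ C) {r : ℝ≥0} (hr : r < 1)
    (t₀ : ℝ) : Tendsto (fun t => eBoundedHolderNorm r (b t - b t₀)) (𝓝 t₀) (𝓝 0) := by
  obtain ⟨C, hC⟩ := h3b
  -- the sup distance between slices tends to `0` (uniform continuity on the compact torus)
  set F : C(ℝ, C(UnitAddTorus d, V)) := ContinuousMap.curry ⟨uncurry b, h1⟩ with hF
  have hFapp : ∀ t x, F t x = b t x := fun t x => rfl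
  have hD : Tendsto (fun t => dist (F t) (F t₀)) (𝓝 t₀) (𝓝 0) :=
    tendsto_iff_dist_tendsto_zero.mp (F.continuous.tendsto t₀)
  have hpt : ∀ t x, ‖(b t - b t₀) x‖ ≤ dist (F t) (F t₀) := fun t x => by
    rw [Pi.sub_apply, ← dist_eq_norm, ← hFapp t x, ← hFapp t₀ x]
    exact ContinuousMap.dist_apply_le_dist x
  -- the differences are Lipschitz, uniformly in time
  have hdiff : ∀ t, IsSmooth (b t - b t₀) := fun t => (h3a t).sub (h3a t₀)
  have hpd : ∀ t (i : d) x, ‖partialDeriv i (b t - b t₀) x‖ ≤ Real.toNNReal (C + C) := by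
    intro t i x
    have e : partialDeriv i (b t - b t₀) x = Torus.lift (partialDeriv i (b t - b t₀)) (repr x) := by
      rw [Torus.lift_apply, proj_repr]
    rw [e, lift_partialDeriv_eq ((hdiff t).isContDiff (by simp))]
    have hl : Torus.lift (b t - b t₀) = Torus.lift (b t) - Torus.lift (b t₀) := by funext y; rfl
    simp only [hl]
    rw [fderiv_sub (((h3a t).differentiable (by simp)) _) (((h3a t₀).differentiable (by simp)) _), sub_apply]
    refine (norm_sub_le _ _).trans ((add_le_add
      ((norm_fderiv_apply_le_norm_iteratedFDeriv_one _ _ (by simp)).trans (hC t _))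
      ((norm_fderiv_apply_le_norm_iteratedFDeriv_one _ _ (by simp)).trans (hC t₀ _))).trans (Real.le_coe_toNNReal _))
  set L : ℝ≥0 := NNReal.sqrt (Fintype.card d) * ∑ _i : d, Real.toNNReal (C + C) with hL
  have hLip : ∀ t, LipschitzWith L (b t - b t₀) := fun t =>
    lipschitzWith_of_norm_partialDeriv_le ((hdiff t).isContDiff (by simp)) (hpd t)
  -- oscillation ≤ twice the sup distance
  have hosc : ∀ t x y, edist ((b t - b t₀) x) ((b t - b t₀) y) ≤ (Real.toNNReal (2 * dist (F t) (F t₀)) : ℝ≥0∞) := by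
    intro t x y
    rw [edist_dist, dist_eq_norm, ENNReal.ofReal]
    refine ENNReal.coe_le_coe.mpr (Real.toNNReal_le_toNNReal ?_)
    calc ‖(b t - b t₀) x - (b t - b t₀) y‖ ≤ ‖(b t - b t₀) x‖ + ‖(b t - b t₀) y‖ := norm_sub_le _ _
      _ ≤ dist (F t) (F t₀) + dist (F t) (F t₀) := add_le_add (hpt t x) (hpt t y)
      _ = 2 * dist (F t) (F t₀) := by ring
  -- the majorant
  have hle : ∀ t, eBoundedHolderNorm r (b t - b t₀) ≤ ENNReal.ofReal (dist (F t) (F t₀)) +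
      (((L + 1) * (Real.toNNReal (2 * dist (F t) (F t₀))) ^ (1 - r : ℝ) : ℝ≥0) : ℝ≥0∞) := fun t =>
    add_le_add (eSupNorm_le_ofReal (hpt t)) (holderWith_of_lipschitzWith_of_osc (hLip t) (hosc t) hr).eHolderNorm_le
  have hlim : Tendsto (fun t => ENNReal.ofReal (dist (F t) (F t₀)) +
      (((L + 1) * (Real.toNNReal (2 * dist (F t) (F t₀))) ^ (1 - r : ℝ) : ℝ≥0) : ℝ≥0∞)) (𝓝 t₀) (𝓝 0) := by
    have h1' : Tendsto (fun t => ENNReal.ofReal (dist (F t) (F t₀))) (𝓝 t₀) (𝓝 0) := by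
      have h := ENNReal.tendsto_ofReal hD
      rwa [ENNReal.ofReal_zero] at h
    have h2' : Tendsto (fun t => ((L + 1) * (Real.toNNReal (2 * dist (F t) (F t₀))) ^ (1 - r : ℝ) : ℝ≥0)) (𝓝 t₀) (𝓝 0) := by
      have hr' : (0 : ℝ) < 1 - r := by
        have : (r : ℝ) < 1 := by exact_mod_cast hr
        linarith
      have ht : Tendsto (fun t => Real.toNNReal (2 * dist (F t) (F t₀))) (𝓝 t₀) (𝓝 0) := by
        have h2 : Tendsto (fun t => 2 * dist (F t) (F t₀)) (𝓝 t₀) (𝓝 0) := by simpa using hD.const_mul 2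
        have h := (continuous_real_toNNReal.tendsto 0).comp h2
        rw [Real.toNNReal_zero] at h
        exact h
      have hp := ((NNReal.continuous_rpow_const hr'.le).tendsto 0).comp ht
      rw [Function.comp_def, NNReal.zero_rpow hr'.ne'] at hp
      simpa using hp.const_mul (L + 1)
    have h := h1'.add (ENNReal.tendsto_coe.2 h2')
    simpa using h
  exact tendsto_of_tendsto_of_tendsto_of_le_of_le tendsto_const_nhds hlim (fun t => bot_le) hle

end Summit.AnomalousDissipation.AnomalousDissipation.Theorems.SolenoidalFractalHomogenisation.LagrangianCarrierConstruction

end
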